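import Summits.BirchSwinnertonDyer.BirchSwinnertonDyer.Theorems.ClassRecordThreeEulerHalvesAtThreeCartanCoverEllipticNullEngine
import Summits.BirchSwinnertonDyer.BirchSwinnertonDyer.Theorems.ClassRecordThreeEulerHalvesAtThreeCartanCoverParabolicPeriods
import HarnessLib

/-!
# The inert-Hecke certificate for (OBS), part D′ — TORSION AND CUSPS: the cochain kills every element of finite order and every parabolic element (theorems only)

Support file for crux `CartanOnePlaceDegreeLawAtThree` (NUM; item stmt-BirchSwinnertonDyer-24801; line `Lines/lattice`, Galois leaf (OBS)). LEAD bsd-stepL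
tam3-p1 g28. Two clauses of the certificate's output (EIG′) `CartanCarayol.PeriodCharacterCuspidalEigenPackageAtThree` (bsd-idea-10 g20, p742701) beyond the
elliptic-null engine of part D:
§1 FINITE ORDER: `pow_three_eq_one_of_pow_nine_eq_one` — no element of `ι(O₀'¹)` has order `9` (the lift to the cover order has INTEGRAL reduced trace `t`
(`Brandt.IsOrder.exists_int_reducedTrace_reducedNorm`, `AlgHom.trace_eq_reducedTrace`); `Z = y³ ≠ 1` would give `Z² + Z + 1 = 0`, `tr Z = −1 = t³ − 3t`,
impossible in `ℤ`); hence `apply_eq_zero_of_isOfFinOrder`: under the engine's hypotheses `χ̄` kills EVERY element of finite order (`n = 3ᵃ·m`, `3 ∤ m`).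
§2 PARABOLIC ELEMENTS: `apply_eq_zero_of_isParabolic` — a `3`-torsion additive cochain `χ̄` on `ι(O₀'¹)` agreeing on `Γ̄(q)` with `(c·per_F)‾` kills every
parabolic `u` (`q ≠ 3`): `(s·u − 1)² = 0` (det `1`, tr `±2`, Cayley–Hamilton), so `u^{2q} = 1 + 2q(s·u − 1)` lies in `Γ̄(q)` and is parabolic, and (PAR) — the THEOREM
`segmentIntegral_eq_zero_of_isParabolic` of `…CartanCoverParabolicPeriods` (periods of cusp forms vanish on parabolic elements; Shimura §8.2) — gives
`χ̄(u^{2q}) = (c·per_F(u^{2q}))‾ = 0`, whence `2q • χ̄(u) = 0 = 3 • χ̄(u)`.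
HONEST: THEOREMS ONLY, sorry-free; nothing about any curve; OBS ∕ 24801 ∕ 23422 ∕ 19109 open; BSD is proved for no curve.
-/

set_option linter.dupNamespace false
set_option autoImplicit false

noncomputable section

open scoped Classical MatrixGroups UpperHalfPlane

namespace Summit.BirchSwinnertonDyer.BirchSwinnertonDyer.Theorems.CartanCover.Charext.InertHecke

open Literature.NumberTheory.Automorphic

section Torsion

variable {D M : ℕ} {C : Finset ℕ} (X : CartanLevelCurveData D M C)

/-! ## §1 Every element of finite order is killed -/

/-- **No element of `ι(O₀'¹)` has order `9`**: `y⁹ = 1 ⇒ y³ = 1`. The reduced trace `t` of the lift of `y` is an INTEGER (`Brandt.IsOrder.exists_int_reducedTrace_reducedNorm`,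
`AlgHom.trace_eq_reducedTrace`); if `Z = y³ ≠ 1` then `Z² + Z + 1 = 0` (§1), so `tr Z = −1`, while Cayley–Hamilton gives `tr y³ = t³ − 3t`; `t³ − 3t + 1 = 0` has no
integer root. [folklore] -/
theorem pow_three_eq_one_of_pow_nine_eq_one {q : ℕ} (y : CartanCover.coverUnits X q) (h9 : y ^ 9 = 1) : y ^ 3 = 1 := by
  obtain ⟨t, -, ht, -⟩ := (CartanCover.isOrder_coverOrder X q).exists_int_reducedTrace_reducedNorm (CartanCover.unitLift y).2
  set Y : Matrix (Fin 2) (Fin 2) ℝ := ((y : GL (Fin 2) ℝ) : Matrix (Fin 2) (Fin 2) ℝ) with hY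
  have htr : Y.trace = (t : ℝ) := by
    rw [hY, ← CartanCover.ι_unitLift, AlgHom.trace_eq_reducedTrace X.ι, ht]; simp
  have hdet : Y.det = 1 := by rw [hY, ← Matrix.GeneralLinearGroup.val_det_apply, y.2.2.2, Units.val_one]
  by_contra h3
  have hval : ∀ n : ℕ, (((y ^ n : CartanCover.coverUnits X q) : GL (Fin 2) ℝ) : Matrix (Fin 2) (Fin 2) ℝ) = Y ^ n := by
    intro n; simp [hY, Units.val_pow_eq_pow_val]
  have hY3ne : Y ^ 3 ≠ 1 := by
    intro h; apply h3; apply Subtype.ext; apply Units.ext; rw [hval]; simpa using h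
  have hY9 : (Y ^ 3) ^ 3 = 1 := by
    rw [← pow_mul, ← hval]
    have := congrArg (fun u : CartanCover.coverUnits X q => ((u : GL (Fin 2) ℝ) : Matrix (Fin 2) (Fin 2) ℝ)) h9
    simpa using this
  have hdet3 : (Y ^ 3).det = 1 := by rw [Matrix.det_pow, hdet, one_pow]
  have hmin := sq_add_self_add_one_eq_zero_of_cube_eq_one (Y ^ 3) hdet3 hY9 hY3ne
  -- Cayley–Hamilton for `Y` and for `Z = Y³`
  have hCH : ∀ (Z : Matrix (Fin 2) (Fin 2) ℝ), Z.det = 1 → Z * Z = Z.trace • Z - 1 := by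
    intro Z hZ
    have h : Z * Z = Z.trace • Z - Z.det • (1 : Matrix (Fin 2) (Fin 2) ℝ) := by
      ext i j
      fin_cases i <;> fin_cases j <;>
        simp [Matrix.mul_apply, Fin.sum_univ_two, Matrix.trace, Matrix.det_fin_two] <;> ring
    rw [h, hZ, one_smul]
  -- `tr Z = -1`
  have htrZ : (Y ^ 3).trace = -1 := by
    have e : ((Y ^ 3).trace + 1) • (Y ^ 3) = 0 := by
      rw [add_smul, one_smul, ← sub_add_cancel ((Y ^ 3).trace • Y ^ 3) 1, ← hCH _ hdet3, ← pow_two]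
      rw [← hmin]; abel
    rcases smul_eq_zero.mp e with h | h
    · linear_combination h
    · exfalso
      have := congrArg Matrix.det h
      rw [hdet3, Matrix.det_zero] at this
      exact one_ne_zero this
  -- `tr Y³ = t³ - 3t`
  have hY2 : Y * Y = (t : ℝ) • Y - 1 := by rw [hCH Y hdet, htr]
  have hY3 : Y ^ 3 = ((t : ℝ) ^ 2 - 1) • Y - (t : ℝ) • (1 : Matrix (Fin 2) (Fin 2) ℝ) := by
    rw [pow_succ, pow_two, hY2, sub_mul, smul_mul_assoc, hY2, one_mul, smul_sub, smul_smul]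
    module
  have htr3 : (Y ^ 3).trace = (t : ℝ) ^ 3 - 3 * t := by
    rw [hY3, Matrix.trace_sub, Matrix.trace_smul, Matrix.trace_smul, htr, Matrix.trace_one, Fintype.card_fin]
    simp only [smul_eq_mul, Nat.cast_ofNat]
    ring
  rw [htr3] at htrZ
  -- `t³ - 3t + 1 = 0` in `ℤ`: `t ∣ 1`, so `t = ±1`, neither works
  have hZt : t ^ 3 - 3 * t + 1 = 0 := by exact_mod_cast (by linear_combination htrZ : (t : ℝ) ^ 3 - 3 * t + 1 = 0)
  have hmul : t * (3 - t ^ 2) = 1 := by linear_combination -hZt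
  rcases Int.eq_one_or_neg_one_of_mul_eq_one hmul with rfl | rfl <;> norm_num at hZt

/-- `v ^ (3 ^ a) = 1 ⇒ v³ = 1` in `ι(O₀'¹)` (no elements of order `9`). [folklore] -/
theorem pow_three_eq_one_of_pow_three_pow_eq_one {q : ℕ} (a : ℕ) :
    ∀ v : CartanCover.coverUnits X q, v ^ 3 ^ a = 1 → v ^ 3 = 1 := by
  induction a with
  | zero => intro v hv; rw [pow_zero, pow_one] at hv; rw [hv, one_pow]
  | succ a ih =>
    intro v hv
    rcases Nat.eq_zero_or_pos a with h0 | hpos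
    · subst h0; simpa using hv
    · -- `w = v ^ 3^(a-1)` has `w⁹ = 1`, hence `w³ = 1`, i.e. `v ^ 3^a = 1`
      obtain ⟨b, rfl⟩ := Nat.exists_eq_succ_of_ne_zero hpos.ne'
      have h9 : (v ^ 3 ^ b) ^ 9 = 1 := by
        rw [← pow_mul, show 3 ^ b * 9 = 3 ^ (b + 1 + 1) by ring]; exact hv
      have h3 := pow_three_eq_one_of_pow_nine_eq_one X (v ^ 3 ^ b) h9
      rw [← pow_mul, ← pow_succ] at h3
      exact ih v h3

/-- **THE ENGINE ON ALL TORSION**: under the hypotheses of `apply_eq_zero_of_cube_eq_one`, `χ̄(u) = 0` for EVERY `u ∈ ι(O₀'¹)` of finite order (`n = 3ᵃ·m`, `3 ∤ m`: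
`(uᵐ)^{3ᵃ} = 1 ⇒ (uᵐ)³ = 1 ⇒ χ̄(uᵐ) = 0 ⇒ m • χ̄(u) = 0 = 3 • χ̄(u)`). This is the clause «null on every element of finite order» of (EIG′)∕(LIFT′).
[cite: ShimuraIATAF1971, Prop. 3.36 and §3.3] -/
theorem apply_eq_zero_of_isOfFinOrder {q : ℕ} [Fact q.Prime] (hq : q ∈ C) (hq3 : q ≠ 3) (R : CartanCover.CoverReduction X q)
    {ℓ : ℕ} [Fact ℓ.Prime] (hℓ : ℓ % 3 = 2) [Fintype (Quotient (X.heckeSetoid ℓ))]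
    (red : CartanCover.coverSubring X q →+* Matrix (Fin 2) (Fin 2) (ZMod ℓ))
    (hred0 : ∀ x : CartanCover.coverSubring X q, red x = 0 ↔ ∃ y ∈ CartanCover.coverOrder X q, (x : X.B) = (ℓ : ℤ) • y)
    (hdet : ∀ x : CartanCover.coverSubring X q, ∃ n : ℤ, reducedNorm ℚ X.B (x : X.B) = n ∧ (red x).det = (n : ZMod ℓ))
    (g : Quotient (X.heckeSetoid ℓ) → X.Gamma)
    (disjU : ∀ (i j : Quotient (X.heckeSetoid ℓ)) (u : GL (Fin 2) ℝ), u ∈ CartanCover.coverUnits X q →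
      ((gammaHeckeDatum X ℓ).changeReps g).α i = u * ((gammaHeckeDatum X ℓ).changeReps g).α j → i = j)
    (stabU : ∀ (u : CartanCover.coverUnits X q) (i : Quotient (X.heckeSetoid ℓ)), ∃ j,
      ((gammaHeckeDatum X ℓ).changeReps g).α i * u * (((gammaHeckeDatum X ℓ).changeReps g).α j)⁻¹ ∈ CartanCover.coverUnits X q)
    (memN : ∀ (β : CartanCover.principalLevel X q) (i : Quotient (X.heckeSetoid ℓ)),
      ((gammaHeckeDatum X ℓ).changeReps g).α i * β *
        (((gammaHeckeDatum X ℓ).changeReps g).α (((gammaHeckeDatum X ℓ).changeReps g).σ ⟨β, CartanCover.principalLevel_le_Gamma X q hq β.2⟩ i))⁻¹ ∈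
        CartanCover.principalLevel X q)
    {A : Type*} [AddCommGroup A] (χ : CartanCover.coverUnits X q → A) (hχ : ∀ a b, χ (a * b) = χ a + χ b) (h3 : ∀ γ, 3 • χ γ = 0)
    (ψ : CartanCover.principalLevel X q → A)
    (hagree : ∀ (β : GL (Fin 2) ℝ) (hβ : β ∈ CartanCover.principalLevel X q),
      χ ⟨β, CartanCover.principalLevel_le_coverUnits X q hβ⟩ = ψ ⟨β, hβ⟩)
    (a : ℤ) (ha : ¬ (3 : ℤ) ∣ a) (heig : ∀ β : CartanCover.principalLevel X q,
      (((gammaHeckeDatum X ℓ).changeReps g).restrict (CartanCover.principalLevel X q) (CartanCover.principalLevel_le_Gamma X q hq) memN).op ψ β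
        = a • ψ β) :
    ∀ u : CartanCover.coverUnits X q, IsOfFinOrder u → χ u = 0 := by
  intro u hu
  obtain ⟨n, hn, hun⟩ := (isOfFinOrder_iff_pow_eq_one).mp hu
  obtain ⟨e, m, hm3, rfl⟩ := Nat.exists_eq_pow_mul_and_not_dvd hn.ne' 3 (by norm_num)
  have hv : (u ^ m) ^ 3 ^ e = 1 := by rw [← pow_mul, mul_comm]; exact hun
  have hv3 : (u ^ m) ^ 3 = 1 := pow_three_eq_one_of_pow_three_pow_eq_one X e (u ^ m) hv
  have hχv : χ (u ^ m) = 0 :=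
    apply_eq_zero_of_cube_eq_one X hq hq3 R hℓ red hred0 hdet g disjU stabU memN χ hχ h3 ψ hagree a ha heig (u ^ m) hv3
  rw [apply_pow_eq_nsmul χ hχ u m] at hχv
  have hsplit : m = 3 * (m / 3) + m % 3 := (Nat.div_add_mod m 3).symm
  have hr : (m % 3) • χ u = 0 := by
    have e3 : (3 * (m / 3)) • χ u = 0 := by rw [mul_nsmul, h3 u, nsmul_zero]
    rw [hsplit, add_nsmul, e3, zero_add] at hχv
    exact hχv
  have hr12 : m % 3 = 1 ∨ m % 3 = 2 := by
    have : m % 3 ≠ 0 := fun h => hm3 (Nat.dvd_of_mod_eq_zero h)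
    omega
  exact eq_zero_of_three_nsmul_of_nsmul (h3 u) (hr12.elim Or.inl (fun h => Or.inr (Or.inl h))) hr


end Torsion

/-! ## §2 Parabolic elements -/

section Parabolic

variable {D M : ℕ} {C : Finset ℕ} (X : CartanLevelCurveData D M C)

/-- `(1 + N)^k = 1 + k • N` for a square-zero matrix `N`. [folklore] -/
theorem one_add_pow_of_sq_eq_zero {R : Type*} [CommRing R] (N : Matrix (Fin 2) (Fin 2) R) (hN : N * N = 0) (k : ℕ) :
    (1 + N) ^ k = 1 + k • N := by
  induction k with
  | zero => simp
  | succ k ih =>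
    rw [pow_succ, ih, add_mul, mul_add, mul_add, one_mul, mul_one, one_mul, smul_mul_assoc, hN, smul_zero, add_zero,
      succ_nsmul]
    abel

/-- A `2 × 2` matrix of determinant `1` and trace `2` is unipotent: `(V − 1)² = 0` (Cayley–Hamilton). [folklore] -/
theorem sub_one_mul_sub_one_eq_zero {R : Type*} [CommRing R] (V : Matrix (Fin 2) (Fin 2) R) (hdet : V.det = 1) (htr : V.trace = 2) :
    (V - 1) * (V - 1) = 0 := by
  have hdet' : V 0 0 * V 1 1 - V 0 1 * V 1 0 = 1 := by rw [← Matrix.det_fin_two]; exact hdet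
  have htr' : V 0 0 + V 1 1 = 2 := by rw [← Matrix.trace_fin_two]; exact htr
  ext i j
  fin_cases i <;> fin_cases j
  · simp [Matrix.mul_apply, Fin.sum_univ_two]
    linear_combination (-1 : R) * hdet' + V 0 0 * htr'
  · simp [Matrix.mul_apply, Fin.sum_univ_two]
    linear_combination V 0 1 * htr'
  · simp [Matrix.mul_apply, Fin.sum_univ_two]
    linear_combination V 1 0 * htr'
  · simp [Matrix.mul_apply, Fin.sum_univ_two]
    linear_combination (-1 : R) * hdet' + V 1 1 * htr'

/-- **PARABOLIC ELEMENTS ARE KILLED**: a `3`-torsion additive cochain `χ̄` on `ι(O₀'¹)` that agrees on `Γ̄(q)` with `(c·per_F)‾` (`F = Q.form`) kills every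
parabolic `u ∈ ι(O₀'¹)` (`q ≠ 3`): with `s = ±1` such that `tr(s·u) = 2`, `N = s·u − 1` has `N² = 0`, so `u^{2q} = (s·u)^{2q} = 1 + 2q·N`; lifting to the cover order
(`N = ι(s·ũ − 1)`) shows `u^{2q} ∈ Γ̄(q)`; it is parabolic (`IsParabolic.pow`), so (PAR) — THEOREM `segmentIntegral_eq_zero_of_isParabolic` — gives `per_F(u^{2q}) = 0`,
whence `2q • χ̄(u) = χ̄(u^{2q}) = 0`; with `3 • χ̄(u) = 0` and `3 ∤ 2q`, `χ̄(u) = 0`. This is the clause «null on every parabolic element» of (EIG′).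
[cite: ShimuraIATAF1971, §8.2] -/
theorem apply_eq_zero_of_isParabolic {q : ℕ} [Fact q.Prime] (hq : q ∈ C) (hq3 : q ≠ 3)
    {W₁ : WeierstrassCurve ℚ} [W₁.IsElliptic] (Q : CartanParametrizationData X W₁) (c : ℂ)
    (χb : CartanCover.coverUnits X q → ℂ ⧸ threeMul Q.L.lattice) (hχb : ∀ a b, χb (a * b) = χb a + χb b) (h3 : ∀ u, 3 • χb u = 0)
    (hagree : ∀ (β : GL (Fin 2) ℝ) (hβ : β ∈ CartanCover.principalLevel X q),
      χb ⟨β, CartanCover.principalLevel_le_coverUnits X q hβ⟩ =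
        redThree Q.L.lattice (c * segmentIntegral (⇑Q.form) Q.basePoint (β • Q.basePoint)))
    (u : CartanCover.coverUnits X q) (hu : Matrix.GeneralLinearGroup.IsParabolic (u : GL (Fin 2) ℝ)) : χb u = 0 := by
  classical
  have hqp : q.Prime := Fact.out
  set U : Matrix (Fin 2) (Fin 2) ℝ := ((u : GL (Fin 2) ℝ) : Matrix (Fin 2) (Fin 2) ℝ) with hU
  have hdet : U.det = 1 := by rw [hU, ← Matrix.GeneralLinearGroup.val_det_apply, u.2.2.2, Units.val_one]
  -- `tr U = ±2`
  have htr2 : U.trace ^ 2 = 2 ^ 2 := by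
    have h := hu.2
    rw [Matrix.discr_fin_two, hdet] at h
    linear_combination h
  obtain ⟨s, hs1, hstr⟩ : ∃ s : ℤ, s * s = 1 ∧ ((s : ℝ) • U).trace = 2 := by
    rcases sq_eq_sq_iff_eq_or_eq_neg.mp htr2 with h | h
    · exact ⟨1, by norm_num, by rw [Matrix.trace_smul, h]; norm_num⟩
    · exact ⟨-1, by norm_num, by rw [Matrix.trace_smul, h]; norm_num⟩
  set V : Matrix (Fin 2) (Fin 2) ℝ := (s : ℝ) • U with hV
  have hs1R : (s : ℝ) * s = 1 := by exact_mod_cast hs1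
  have hVdet : V.det = 1 := by
    rw [hV, Matrix.det_smul, Fintype.card_fin, hdet, mul_one, pow_two, hs1R]
  have hN : (V - 1) * (V - 1) = 0 := sub_one_mul_sub_one_eq_zero V hVdet hstr
  -- `U^{2q} = V^{2q} = 1 + 2q • (V - 1)`
  have hUpow : U ^ (2 * q) = 1 + (2 * q) • (V - 1) := by
    have e : U ^ (2 * q) = V ^ (2 * q) := by
      have hs2q : (s : ℝ) ^ (2 * q) = 1 := by rw [pow_mul, pow_two, hs1R, one_pow]
      rw [hV, smul_pow, hs2q, one_smul]
    rw [e, ← one_add_pow_of_sq_eq_zero (V - 1) hN (2 * q), add_sub_cancel]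
  -- the lift to the cover order: `ũ^{2q} - 1 = q • (2 • (s ũ - 1))`
  set ut : CartanCover.coverSubring X q := CartanCover.unitLift u with hut
  have hιu : X.ι (ut : X.B) = U := by rw [hut, CartanCover.ι_unitLift]
  let Nt : CartanCover.coverSubring X q :=
    ⟨(s : ℤ) • (ut : X.B) - 1, (CartanCover.coverSubring X q).sub_mem ((CartanCover.coverSubring X q).zsmul_mem ut.2 s)
      (CartanCover.coverSubring X q).one_mem⟩
  have hιN : X.ι (Nt : X.B) = V - 1 := by
    show X.ι ((s : ℤ) • (ut : X.B) - 1) = V - 1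
    rw [map_sub, map_zsmul, map_one, hιu, hV, ← Int.cast_smul_eq_zsmul ℝ]
  have hmem : ((u ^ (2 * q) : CartanCover.coverUnits X q) : GL (Fin 2) ℝ) ∈ CartanCover.principalLevel X q := by
    refine ⟨(u ^ (2 * q)).2, (ut ^ (2 * q) : CartanCover.coverSubring X q), (ut ^ (2 * q)).2, ?_, (2 : ℤ) • (Nt : X.B),
      (CartanCover.coverOrder X q).smul_mem 2 Nt.2, ?_⟩
    · rw [Subring.coe_pow, map_pow, hιu, hU, Subgroup.coe_pow, Units.val_pow_eq_pow_val]
    · apply X.ι_injective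
      rw [map_sub, Subring.coe_pow, map_pow, hιu, map_one, hUpow, add_sub_cancel_left, map_zsmul, map_zsmul, hιN,
        ← Nat.cast_smul_eq_nsmul ℝ, ← Int.cast_smul_eq_zsmul ℝ, ← Int.cast_smul_eq_zsmul ℝ, smul_smul]
      congr 1
      push_cast
      ring
  -- (PAR) at `β = u^{2q}`, parabolic and in `X.Gamma`
  have hpar : Matrix.GeneralLinearGroup.IsParabolic (((u ^ (2 * q) : CartanCover.coverUnits X q) : GL (Fin 2) ℝ)) := by
    rw [Subgroup.coe_pow]
    exact hu.pow (mul_ne_zero two_ne_zero hqp.ne_zero)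
  have hper : segmentIntegral (⇑Q.form) Q.basePoint ((((u ^ (2 * q) : CartanCover.coverUnits X q) : GL (Fin 2) ℝ)) • Q.basePoint) = 0 :=
    segmentIntegral_eq_zero_of_isParabolic Q.form (CartanCover.principalLevel_le_Gamma X q hq hmem) hpar Q.basePoint
  have h2q : (2 * q) • χb u = 0 := by
    rw [← apply_pow_eq_nsmul χb hχb u (2 * q)]
    have h := hagree _ hmem
    rw [hper, mul_zero, map_zero] at h
    have e : (⟨((u ^ (2 * q) : CartanCover.coverUnits X q) : GL (Fin 2) ℝ), CartanCover.principalLevel_le_coverUnits X q hmem⟩ :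
        CartanCover.coverUnits X q) = u ^ (2 * q) := Subtype.ext rfl
    rw [e] at h
    exact h
  -- `3 ∤ 2q`
  have hr12 : (2 * q) % 3 = 1 ∨ (2 * q) % 3 = 2 := by
    have h3q : ¬ 3 ∣ q := fun h => hq3 ((Nat.prime_dvd_prime_iff_eq Nat.prime_three hqp).mp h).symm
    have : ¬ 3 ∣ 2 * q := by
      intro h
      rcases (Nat.Prime.dvd_mul Nat.prime_three).mp h with h | h
      · omega
      · exact h3q h
    omega
  have hr : ((2 * q) % 3) • χb u = 0 := by
    have e3 : (3 * (2 * q / 3)) • χb u = 0 := by rw [mul_nsmul, h3 u, nsmul_zero]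
    rw [← Nat.div_add_mod (2 * q) 3, add_nsmul, e3, zero_add] at h2q
    exact h2q
  exact eq_zero_of_three_nsmul_of_nsmul (h3 u) (hr12.elim Or.inl (fun h => Or.inr (Or.inl h))) hr

end Parabolic

end Summit.BirchSwinnertonDyer.BirchSwinnertonDyer.Theorems.CartanCover.Charext.InertHecke

end
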